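import Mathlib
import Literature.Probability.Moments.HoeffdingCounting
import Literature.Probability.RandomPlanarGeometry.PlanarSRWMaximalTail
import HarnessLib

/-!
# Route `TautLoopKelvin`, crux `TautLoopLaw` (stmt-NavierStokesRegularity-15249), line
  `Sketch-ideas-r1k1` (Dini–Saks architecture) — tools stub `stub_tautLoopStepWalkTailTools`

**Tail count for the lazy coordinate walk in `ℝ³`.** A path `p : Fin n → Fin 6` of the
random-walk selection encodes the steps `(±a) e_c`, `c = (p j)/2 ∈ Fin 3`, sign `+` iff `p j` is
even; `S_k(p) = Σ_{j<k} step_j`. We bound the number of paths leaving the ball of radius `λ` before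
time `n`:

  `#{p : ∃ k ≤ n, λ < ‖S_k(p)‖} ≤ 12 · 6ⁿ · exp(-λ² / (6 n a²))`.

Proof (pure finite combinatorics): `λ < ‖S_k‖` forces `λ/√3 < |S_k ⬝ e_i|` for some coordinate
`i` (union bound over the `3` coordinates); the `i`-th coordinate of the walk is `a` times the
integer walk with weight `w_i(c) ∈ {+1, -1, 0}` (`+1` on colour `2i`, `-1` on `2i+1`), which is
reversed by the colour swap `2i ↔ 2i+1`, so the reflection principle / Lévy inequality of
`Literature.Probability.RandomPlanarGeometry.PlanarSRWMaximalTail` (`card_filter_max_abs_ge_le`,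
`#{max_j |X_j| ≥ μ} ≤ 4 #{X_n ≥ μ}`) applies; finally the counting Hoeffding inequality
`Literature.Probability.Moments.hoeffding_count_pi` (mean-zero weights bounded by `1`) gives
`#{X_n ≥ μ} ≤ 6ⁿ exp(-μ²/(2n))` with `μ = λ/(a√3)`, i.e. `exp(-λ²/(6 n a²))`; `3 · 4 = 12`.
Everything is folklore.
-/

noncomputable section

open Finset Real
open Literature.Probability.RandomPlanarGeometry.PlaneNonIntersection
  (psum psum_self card_filter_max_abs_ge_le)
open Literature.Probability.Moments (hoeffding_count_pi)

namespace Summit.NavierStokesRegularity.NavierStokesRegularity.Theorems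

set_option linter.dupNamespace false

-- the integer weight of colour `c : Fin 6` on coordinate `i : Fin 3`
local notation3 "W[" i "]" => (fun c : Fin 6 =>
  (if (c : ℕ) / 2 = ((i : Fin 3) : ℕ) then (if (c : ℕ) % 2 = 0 then (1 : ℤ) else -1) else 0))

-- the colour swap `2i ↔ 2i+1`
local notation3 "SW" => (![1, 0, 3, 2, 5, 4] : Fin 6 → Fin 6)

/-! ## The colour weights -/

/-- The colour swap `2i ↔ 2i + 1` is an involution of `Fin 6`. [folklore] -/
theorem tautLoopWalk_swap_involutive : Function.Involutive SW := by
  intro b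
  fin_cases b <;> rfl

/-- The colour swap reverses every coordinate weight. [folklore] -/
theorem tautLoopWalk_weight_swap (i : Fin 3) (b : Fin 6) : W[i] (SW b) = -(W[i] b) := by
  revert i b
  decide

/-- Every coordinate weight has mean zero over the six colours. [folklore] -/
theorem tautLoopWalk_weight_sum (i : Fin 3) : ∑ b : Fin 6, ((W[i] b : ℤ) : ℝ) = 0 := by
  have h : ∑ b : Fin 6, W[i] b = 0 := by revert i; decide
  rw [← Int.cast_sum, h, Int.cast_zero]

/-- Every coordinate weight is bounded by `1`. [folklore] -/
theorem tautLoopWalk_weight_abs (i : Fin 3) (b : Fin 6) : |((W[i] b : ℤ) : ℝ)| ≤ 1 := by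
  have h : -1 ≤ W[i] b ∧ W[i] b ≤ 1 := by revert i b; decide
  rw [abs_le]
  exact ⟨by exact_mod_cast h.1, by exact_mod_cast h.2⟩

/-! ## Coordinates of the vector walk -/

/-- The `i`-th coordinate of the step of colour `c` is `a · w_i(c)`. [folklore] -/
theorem tautLoopWalk_step_apply (a : ℝ) (c : Fin 6) (i : Fin 3) :
    ((if (c : ℕ) % 2 = 0 then a else -a) •
        EuclideanSpace.single (⟨(c : ℕ) / 2, by omega⟩ : Fin 3) (1:ℝ)) i =
      a * ((if (c : ℕ) / 2 = (i : ℕ) then (if (c : ℕ) % 2 = 0 then (1 : ℤ) else -1) else 0 : ℤ)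
        : ℝ) := by
  rw [PiLp.smul_apply, PiLp.single_apply, smul_eq_mul]
  split_ifs <;> simp_all [Fin.ext_iff]

/-- The `i`-th coordinate of the partial sum `S_k(p)` of the vector walk is `a` times the integer
partial sum of the weights `w_i`. [folklore] -/
theorem tautLoopWalk_sum_apply {n : ℕ} (a : ℝ) (p : Fin n → Fin 6) (k : ℕ) (i : Fin 3) :
    (∑ j ∈ Finset.univ.filter (fun j : Fin n => (j : ℕ) < k),
        (if (p j : ℕ) % 2 = 0 then a else -a) •
          EuclideanSpace.single (⟨(p j : ℕ) / 2, by omega⟩ : Fin 3) (1:ℝ)) i =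
      a * (psum W[i] p k : ℝ) := by
  rw [WithLp.ofLp_sum, Finset.sum_apply,
    Finset.sum_congr rfl fun j _ => tautLoopWalk_step_apply a (p j) i, psum, Int.cast_sum,
    Finset.mul_sum, Finset.sum_filter]
  refine Finset.sum_congr rfl fun j _ => ?_
  split_ifs <;> simp

/-- If `λ < ‖v‖` in `ℝ³` (`λ ≥ 0`), some coordinate of `v` exceeds `λ/√3` in absolute value.
[folklore] -/
theorem tautLoopWalk_exists_coord {lam : ℝ} (hlam : 0 ≤ lam) (v : EuclideanSpace ℝ (Fin 3))
    (h : lam < ‖v‖) : ∃ i : Fin 3, lam / √3 < |v i| := by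
  by_contra hcon
  simp only [not_exists, not_lt] at hcon
  have hsq3 : (√3 : ℝ) ^ 2 = 3 := Real.sq_sqrt (by norm_num)
  have hi : ∀ i, (v i) ^ 2 ≤ lam ^ 2 / 3 := fun i =>
    calc (v i) ^ 2 = |v i| ^ 2 := (sq_abs _).symm
      _ ≤ (lam / √3) ^ 2 := pow_le_pow_left₀ (abs_nonneg _) (hcon i) 2
      _ = lam ^ 2 / 3 := by rw [div_pow, hsq3]
  have hnorm : ‖v‖ ^ 2 ≤ lam ^ 2 := by
    rw [EuclideanSpace.real_norm_sq_eq, Fin.sum_univ_three]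
    linarith [hi 0, hi 1, hi 2]
  exact absurd h (not_lt.2 ((pow_le_pow_iff_left₀ (norm_nonneg v) hlam two_ne_zero).1 hnorm))

/-! ## Bookkeeping and the tail bound -/

/-- Union-bound bookkeeping: if `S` is covered by `T₀ ∪ T₁ ∪ T₂`, `#Tᵢ ≤ 4 #Bᵢ` and `#Bᵢ ≤ K`,
then `#S ≤ 12 K`. [folklore] -/
theorem tautLoopWalk_combine {α : Type*} {S : Finset α} {T B : Fin 3 → Finset α} (K : ℝ)
    (hS : ∀ p ∈ S, ∃ i, p ∈ T i) (hT : ∀ i, #(T i) ≤ 4 * #(B i))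
    (hB : ∀ i, (#(B i) : ℝ) ≤ K) : (#S : ℝ) ≤ 12 * K := by
  classical
  have h1 : #S ≤ ∑ i, #(T i) :=
    calc #S ≤ #(Finset.univ.biUnion T) := Finset.card_le_card fun p hp => by
          obtain ⟨i, hi⟩ := hS p hp
          exact Finset.mem_biUnion.2 ⟨i, Finset.mem_univ _, hi⟩
      _ ≤ ∑ i, #(T i) := Finset.card_biUnion_le
  have h2 : ∀ i, (#(T i) : ℝ) ≤ 4 * K := fun i =>
    calc (#(T i) : ℝ) ≤ ((4 * #(B i) : ℕ) : ℝ) := by exact_mod_cast hT i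
      _ = 4 * (#(B i) : ℝ) := by push_cast; ring
      _ ≤ 4 * K := by linarith [hB i]
  calc (#S : ℝ) ≤ ((∑ i, #(T i) : ℕ) : ℝ) := by exact_mod_cast h1
    _ = ∑ i, (#(T i) : ℝ) := by push_cast; rfl
    _ ≤ ∑ _i : Fin 3, 4 * K := Finset.sum_le_sum fun i _ => h2 i
    _ = 12 * K := by
        rw [Finset.sum_const, Finset.card_univ, Fintype.card_fin, nsmul_eq_mul]
        push_cast
        ring

/-- **Tail count for the lazy coordinate walk** (binder form of the tools stub): the number of
paths `p : Fin n → Fin 6` whose vector walk leaves the closed ball of radius `λ` at some time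
`k ≤ n` is at most `12 · 6ⁿ · exp(-λ²/(6 n a²))` (union bound over coordinates, reflection
principle, Hoeffding). [folklore] -/
theorem tautLoopWalk_tail (n : ℕ) (a lam : ℝ) (ha : 0 < a) (hlam : 0 < lam) (hn : 0 < n) :
    ((Finset.univ.filter (fun p : Fin n → Fin 6 => ∃ k : ℕ, k ≤ n ∧ lam <
      ‖∑ j ∈ Finset.univ.filter (fun j : Fin n => (j : ℕ) < k),
        (if (p j : ℕ) % 2 = 0 then a else -a) •
          EuclideanSpace.single (⟨(p j : ℕ) / 2, by omega⟩ : Fin 3) (1:ℝ)‖)).card : ℝ) ≤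
      12 * (6 : ℝ) ^ n * Real.exp (-(lam ^ 2) / (6 * n * a ^ 2)) := by
  have hsq3 : (√3 : ℝ) ^ 2 = 3 := Real.sq_sqrt (by norm_num)
  have ha' : a ≠ 0 := ha.ne'
  have hn' : (n : ℝ) ≠ 0 := Nat.cast_ne_zero.2 hn.ne'
  set μ' : ℝ := lam / √3 / a with hμ'
  have hμ'0 : 0 ≤ μ' := by positivity
  -- the reflection principle for each coordinate walk (literature)
  have hT := fun i : Fin 3 =>
    card_filter_max_abs_ge_le (n := n) W[i] tautLoopWalk_swap_involutive
      (tautLoopWalk_weight_swap i) μ'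
  refine le_trans (b := 12 * ((6 : ℝ) ^ n * Real.exp (-(lam ^ 2) / (6 * n * a ^ 2)))) ?_
    (le_of_eq (by ring))
  refine tautLoopWalk_combine _ ?_ hT ?_
  · -- covering: `λ < ‖S_k‖` ⇒ `μ' ≤ |X^i_k|` for some coordinate `i`
    intro p hp
    rw [Finset.mem_filter] at hp
    obtain ⟨k, hk, hlt⟩ := hp.2
    obtain ⟨i, hi⟩ := tautLoopWalk_exists_coord hlam.le _ hlt
    rw [tautLoopWalk_sum_apply, abs_mul, abs_of_pos ha] at hi
    refine ⟨i, Finset.mem_filter.2 ⟨Finset.mem_univ _, k, hk, ?_⟩⟩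
    exact ((div_lt_iff₀' ha).2 hi).le
  · -- Hoeffding for the final value of each coordinate walk (literature)
    intro i
    have hh := hoeffding_count_pi (ι := Fin n) (κ := fun _ => Fin 6)
      (fun _ c => ((W[i] c : ℤ) : ℝ)) (fun _ => (1:ℝ)) (fun _ => tautLoopWalk_weight_sum i)
      (fun _ c => tautLoopWalk_weight_abs i c) hμ'0
      (by simp only [one_pow, Finset.sum_const, Finset.card_univ, Fintype.card_fin,
            nsmul_eq_mul, mul_one]; exact_mod_cast hn)
    refine le_trans ?_ (hh.trans_eq ?_)
    · refine Nat.cast_le.2 (Finset.card_le_card fun y hy => ?_)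
      rw [Finset.mem_filter] at hy ⊢
      refine ⟨Finset.mem_univ _, ?_⟩
      have h2 := hy.2
      rw [psum_self, Int.cast_sum] at h2
      exact h2
    · simp only [one_pow, Finset.sum_const, Finset.card_univ, Fintype.card_fin, nsmul_eq_mul,
        mul_one, Finset.prod_const]
      push_cast
      rw [mul_comm]
      congr 2
      rw [hμ', div_pow, div_pow, hsq3]
      field_simp
      ring

/-! ## The tools stub -/

/-- **Tools stub `stub_tautLoopStepWalkTailTools`** (registered; serves the random-walk selection
`6A` and the step-from-selection `6B` of line `Sketch-ideas-r1k1`): counting tail bound for the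
lazy coordinate random walk with step length `a` in `ℝ³` — among the `6ⁿ` paths, at most
`12 · 6ⁿ · exp(-λ²/(6 n a²))` leave the ball of radius `λ` at some time `k ≤ n`. [folklore] -/
theorem stub_tautLoopStepWalkTailTools : ∀ (n : ℕ) (a lam : ℝ), 0 < a → 0 < lam → 0 < n →
    ((Finset.univ.filter (fun p : Fin n → Fin 6 => ∃ k : ℕ, k ≤ n ∧ lam < ‖∑ j ∈
    Finset.univ.filter (fun j : Fin n => (j : ℕ) < k), (if (p j : ℕ) % 2 = 0 then a else -a) •
    EuclideanSpace.single (⟨(p j : ℕ) / 2, by omega⟩ : Fin 3) (1:ℝ)‖)).card : ℝ) ≤ 12 * (6 : ℝ)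
    ^ n * Real.exp (-(lam ^ 2) / (6 * n * a ^ 2)) :=
  tautLoopWalk_tail

end Summit.NavierStokesRegularity.NavierStokesRegularity.Theorems

end
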